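import Summits.QuantumFields.BalabanUV.T4Continuum.Support.NE7ConstantFluxBackground
import HarnessLib

/-!
# NE7SliceLetterConstantFluxWitness — A CONCRETE ADMISSIBLE BACKGROUND AT WHICH F123d's SLICE-SOLVER LETTER (L2) FAILS: `B = diag(2πi∕P, 0, …, 0)`, `ζ = E₁₂ − E₂₁` on `card n ≥ 2`;
# the constant-flux background of F129 with this `B` is unitary, `P`-periodic (`P = N·L^{j+1}`), of plaquette radius `≤ 2π∕P`, has zero plaquette∕flux gradients, is critical on
# every periodic direction, and `ζ − Ad_{e^{B}}ζ ≠ 0` — so for every `L ≥ 2`, `j`, `d ≥ 2` and all LARGE `N` the hypothesis `hG` of F123d is UNSATISFIABLE at a background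
# satisfying all of F123d's background hypotheses (file 60 of the curved (APE))

Cell `pub-balaban`, rung (B)+1 sub-cell t4, lineage `b2b-balaban-t4-ne7-p1` (CRUX PROVER NE7 #1 = OWNER of row NE7), generation 80; memo
`t4/b2b-balaban-t4-ne7-p1-g80/SLICE-LETTER-OBSTRUCTION.md` §2.  File F130, over F129 `NE7ConstantFluxBackground.sliceLetter_false_constFlux` and Mathlib's `Matrix.exp_diagonal`,
`Matrix.l2_opNorm_diagonal`, `Complex.exp_eq_one_iff`, `Real.norm_exp_I_mul_ofReal_sub_one_le`.
WHAT ([folklore]; 0 def, 0 sorry; the two matrices enter through EQUATIONAL HYPOTHESES `hB : B = diagonal (i ↦ if i = i₀ then θ·I else 0)`, `hζ : ζ = of (…)`).  §1 the phase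
matrix: skew, `e^{cB} = diag(…, e^{cθ i}, …)`, `e^{PB} = 1` for `θ = 2π∕P`, `‖e^{cB} − 1‖ ≤ |cθ|`; §2 the skew unit `ζ` and `ζ − Ad_{e^{B}}ζ ≠ 0` whenever `e^{θ i} ≠ 1` (entry
`(i₀,i₁)` is `1 − e^{θ i}`); `exp_ne_one_of_two_le` (`e^{2πi∕P} ≠ 1` for `P ≥ 2`); §3 **`sliceLetter_false_witness`**: for `d`, `κ₀ ≠ κ₁`, `i₀ ≠ i₁`, `L ≥ 2`, `N ≥ 1`, `j`, the
background `W(y,κ₁) = e^{y_{κ₀}B}` (else `1`) with `B` as above at `P = N·L^{j+1}`: whenever `LevelSmall d L j a` for some `a ≥ 2π∕P`, F123d's `hS`∕`hG` ⟹ `False`; §4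
**`exists_admissible_background_not_sliceLetter`**: for `d ≥ 2`, `card n ≥ 2`, `L ≥ 2` and EVERY `j` THERE ARE `N ≥ 1`, `x ≥ 0` and a background `W` satisfying every `W`-hypothesis
of F123d (unitary, periodic, `LevelSmall j x`, `LevelSmall (j+1) x`, `SmallField W x`, tangent-critical, plaquette gradient `0`, flux gradient `0`) at which NO `S ⊇ {W-tangent skew
periodic}` and NO `K_G` satisfy `hG`.
HONEST FRAMING (page 1): explicit `2 × 2`-block matrix algebra and the F129 background; a NEGATIVE result about OUR letter (L2) as typed (the END F123d is vacuous at admissible data);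
nothing of Bałaban's asserted; the flat (152) untouched; NOT ONE-STEP, NOT NE7; spine 0∕9; finite T⁴ rung (B)+1 — NOT infinite volume, NOT mass gap, NOT `BetaPertH`, NOT Clay.
Continuum YM on T⁴ ⇐ BetaPertH ∧ nine spine estimates (0/9 proved); BetaPertH ⇐ (D1) ∧ (D4) ∧ CAP+tail; G-an2-4 gates asym, D1 and NE2/3/4.
-/

set_option autoImplicit false

open scoped BigOperators Matrix.Norms.L2Operator
open NormedSpace Finset

namespace Summit.QuantumFields.BalabanUV.T4Continuum.NE7SliceLetterConstantFluxWitness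

open Literature.MathematicalPhysics.QuantumFieldTheory.Balaban1983to89
open B7Prop1Explicit B7Prop2Explicit MatrixLog UnitaryModel
open T4AveragingDeficitWall hiding Site Plane Plaq Bond
open T4AveragingDeficitWallBoundary (IsPeriodicCfg periodBox)
open AveragingDeficitPeriodicCounting (IsPeriodicDir)
open AveragingDeficitMultiLevelPrep (LevelSmall levelSmall_of_pow)
open AveragingDeficitTwoLevelPrep (twoLevelSmall)
open MinimalActionLevels (perWin)
open NE3HessForm (hess dAction)
open NE3TangentCovariantTower (dirIter)
open NE7ConstantFluxBackground

noncomputable section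

variable {n : Type*} [Fintype n] [DecidableEq n]

/-! ## §1 The phase matrix `B = diag(θ i at i₀, 0 elsewhere)` -/

section Phase

variable {i₀ : n} {θ : ℝ} {B : Matrix n n ℂ}

omit [Fintype n] in
/-- `B` is skew-adjoint. [folklore] -/
theorem skew_phase (hB : B = Matrix.diagonal (fun i => if i = i₀ then ((θ : ℂ) * Complex.I) else 0)) : B ∈ skewAdjoint (Matrix n n ℂ) := by
  rw [skewAdjoint.mem_iff, hB, Matrix.star_eq_conjTranspose, Matrix.diagonal_conjTranspose, Matrix.diagonal_neg]
  congr 1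
  funext i
  simp only [Pi.star_apply]
  split_ifs
  · simp [Complex.conj_ofReal, Complex.conj_I]
  · simp

/-- The exponentials of the multiples of `B` are the diagonal phase matrices. [folklore] -/
theorem exp_smul_phase (hB : B = Matrix.diagonal (fun i => if i = i₀ then ((θ : ℂ) * Complex.I) else 0)) (c : ℂ) :
    exp (c • B) = Matrix.diagonal (fun i => if i = i₀ then Complex.exp (c * ((θ : ℂ) * Complex.I)) else 1) := by
  rw [hB, ← Matrix.diagonal_smul, Matrix.exp_diagonal]
  congr 1
  funext i
  rw [Pi.exp_def, ← Complex.exp_eq_exp_ℂ]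
  simp only [Pi.smul_apply, smul_eq_mul]
  split_ifs
  · rfl
  · rw [mul_zero, Complex.exp_zero]

/-- For `θ = 2π∕P`, `e^{PB} = 1`. [folklore] -/
theorem expUnit_period_phase (hB : B = Matrix.diagonal (fun i => if i = i₀ then ((θ : ℂ) * Complex.I) else 0)) {P : ℕ} (hP : 0 < P)
    (hθ : θ = 2 * Real.pi / P) : expUnit ((P : ℂ) • B) = 1 := by
  apply Units.ext
  rw [val_expUnit, exp_smul_phase hB, Units.val_one, ← Matrix.diagonal_one]
  congr 1
  funext i
  split_ifs
  · have hPθ : (P : ℂ) * ((θ : ℂ) * Complex.I) = 2 * Real.pi * Complex.I := by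
      have hP0 : (P : ℂ) ≠ 0 := by exact_mod_cast hP.ne'
      rw [hθ]
      push_cast
      field_simp
    rw [hPθ, Complex.exp_two_pi_mul_I]
  · rfl

/-- `‖e^{cB} − 1‖ ≤ |c·θ|` for real `c` (the diagonal phase `e^{icθ} − 1` at `i₀`, `0` elsewhere). [folklore] -/
theorem norm_exp_smul_phase_sub_one_le (hB : B = Matrix.diagonal (fun i => if i = i₀ then ((θ : ℂ) * Complex.I) else 0)) (c : ℝ) :
    ‖exp (((c : ℂ)) • B) - 1‖ ≤ |c * θ| := by
  rw [exp_smul_phase hB, ← Matrix.diagonal_one, Matrix.diagonal_sub, Matrix.l2_opNorm_diagonal]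
  refine (pi_norm_le_iff_of_nonneg (abs_nonneg _)).2 fun i => ?_
  split_ifs
  · have h := Real.norm_exp_I_mul_ofReal_sub_one_le (x := c * θ)
    have heq : Complex.I * ((c * θ : ℝ) : ℂ) = (c : ℂ) * ((θ : ℂ) * Complex.I) := by push_cast; ring
    rw [heq] at h
    simpa [Real.norm_eq_abs] using h
  · simpa using abs_nonneg (c * θ)

end Phase

/-! ## §2 The skew unit `ζ = E_{i₀i₁} − E_{i₁i₀}` -/

section Zeta

variable {i₀ i₁ : n} {θ : ℝ} {B ζ : Matrix n n ℂ}

omit [Fintype n] in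
/-- `ζ` is skew-adjoint (real antisymmetric). [folklore] -/
theorem skew_zeta (h01 : i₀ ≠ i₁)
    (hζ : ζ = Matrix.of (fun a b => if a = i₀ ∧ b = i₁ then (1 : ℂ) else if a = i₁ ∧ b = i₀ then -1 else 0)) :
    ζ ∈ skewAdjoint (Matrix n n ℂ) := by
  rw [skewAdjoint.mem_iff, Matrix.star_eq_conjTranspose, hζ]
  ext a b
  simp only [Matrix.conjTranspose_apply, Matrix.of_apply, Matrix.neg_apply]
  by_cases h1 : a = i₀ ∧ b = i₁
  · rw [if_pos h1, if_neg (fun h => h01 (h1.1.symm.trans h.2)), if_pos ⟨h1.2, h1.1⟩]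
    simp
  · rw [if_neg h1]
    by_cases h2 : a = i₁ ∧ b = i₀
    · rw [if_pos h2, if_pos ⟨h2.2, h2.1⟩]
      simp
    · rw [if_neg h2, if_neg (fun h => h2 ⟨h.2, h.1⟩), if_neg (fun h => h1 ⟨h.2, h.1⟩)]
      simp

/-- **`ζ − Ad_{e^{B}}ζ ≠ 0`** as soon as `e^{θ i} ≠ 1`: its `(i₀,i₁)` entry is `1 − e^{θ i}`. [folklore] -/
theorem zeta_sub_Ad_ne_zero (h01 : i₀ ≠ i₁) (hB : B = Matrix.diagonal (fun i => if i = i₀ then ((θ : ℂ) * Complex.I) else 0))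
    (hζ : ζ = Matrix.of (fun a b => if a = i₀ ∧ b = i₁ then (1 : ℂ) else if a = i₁ ∧ b = i₀ then -1 else 0))
    (hθ1 : Complex.exp ((θ : ℂ) * Complex.I) ≠ 1) : ζ - Ad (expUnit B) ζ ≠ 0 := by
  intro h
  have hent := congrFun (congrFun h i₀) i₁
  have hAd : Ad (expUnit B) ζ = exp ((1 : ℂ) • B) * ζ * exp ((-1 : ℂ) • B) := by
    simp only [Ad, val_inv_expUnit, val_expUnit, one_smul, neg_smul]
  rw [Matrix.sub_apply, hAd, exp_smul_phase hB, exp_smul_phase hB, Matrix.mul_diagonal, Matrix.diagonal_mul, hζ, Matrix.of_apply,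
    if_pos ⟨rfl, rfl⟩, if_pos rfl, if_neg (Ne.symm h01), Matrix.zero_apply] at hent
  simp only [one_mul, mul_one] at hent
  exact hθ1 (sub_eq_zero.mp hent).symm

omit [Fintype n] [DecidableEq n] in
/-- `e^{2πi∕P} ≠ 1` for `P ≥ 2`. [folklore] -/
theorem exp_ne_one_of_two_le {P : ℕ} (hP : 2 ≤ P) : Complex.exp ((((2 * Real.pi / P : ℝ)) : ℂ) * Complex.I) ≠ 1 := by
  intro h
  obtain ⟨m, hm⟩ := Complex.exp_eq_one_iff.mp h
  have hP0 : (0 : ℝ) < P := by exact_mod_cast (lt_of_lt_of_le (by norm_num) hP)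
  -- compare imaginary parts: `2π∕P = 2πm`
  have him := congrArg Complex.im hm
  simp only [Complex.mul_im, Complex.ofReal_re, Complex.ofReal_im, Complex.I_re, Complex.I_im, mul_zero, mul_one, zero_add,
    Complex.mul_re, Complex.intCast_re, Complex.intCast_im, Complex.re_ofNat, Complex.im_ofNat, zero_mul, sub_zero] at him
  -- `him : 2π/P = m * (2π)` (up to normalisation)
  have hpi : 0 < Real.pi := Real.pi_pos
  have him' : (2 * Real.pi / P : ℝ) = (m : ℝ) * (2 * Real.pi) := by simpa using him
  have h2 : (2 * Real.pi / P : ℝ) * P = 2 * Real.pi := div_mul_cancel₀ _ (ne_of_gt hP0)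
  have key : ((m : ℝ) * P) * (2 * Real.pi) = 1 * (2 * Real.pi) := by
    calc ((m : ℝ) * P) * (2 * Real.pi) = ((m : ℝ) * (2 * Real.pi)) * P := by ring
      _ = (2 * Real.pi / P : ℝ) * P := by rw [him']
      _ = 2 * Real.pi := h2
      _ = 1 * (2 * Real.pi) := (one_mul _).symm
  have hmP : (m : ℝ) * P = 1 := mul_right_cancel₀ (by positivity) key
  have hm_pos : 0 < m := by
    by_contra hle
    have hle' : (m : ℝ) ≤ 0 := by exact_mod_cast (not_lt.mp hle)
    have : (m : ℝ) * P ≤ 0 := mul_nonpos_of_nonpos_of_nonneg hle' hP0.le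
    linarith
  have hm1 : (1 : ℝ) ≤ m := by exact_mod_cast hm_pos
  have hP2 : (2 : ℝ) ≤ P := by exact_mod_cast hP
  nlinarith

end Zeta

/-! ## §3 The witness: F123d's letter fails at the constant-flux background with `B = diag(2πi∕P, 0, …)` -/

/-- **THE CONCRETE WITNESS**: `κ₀ ≠ κ₁` in `Fin d`, `i₀ ≠ i₁` in `n`, `L ≥ 2`, `N ≥ 1`, `j`, `P = N·L^{j+1}`, `θ = 2π∕P`; the background `W(y,κ₁) = e^{y_{κ₀}B}` (else `1`); any
`a ≥ 2π∕P` with `LevelSmall d L j a`.  Then F123d's `hS`∕`hG` at this `W` ⟹ `False` (F129 with `ζ = E_{i₀i₁} − E_{i₁i₀}`). [folklore] -/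
theorem sliceLetter_false_witness [Nonempty n] {d : ℕ} {κ₀ κ₁ : Fin d} (hκ : κ₀ ≠ κ₁) {i₀ i₁ : n} (h01 : i₀ ≠ i₁)
    {L N : ℕ} [NeZero N] (hL : 2 ≤ L) (j : ℕ) {θ : ℝ} (hθ : θ = 2 * Real.pi / ((N * L ^ (j + 1) : ℕ) : ℝ))
    {B : Matrix n n ℂ} (hB : B = Matrix.diagonal (fun i => if i = i₀ then ((θ : ℂ) * Complex.I) else 0))
    {W : Site d → Fin d → (Matrix n n ℂ)ˣ} (hW : ∀ (y : Site d) (κ : Fin d), W y κ = if κ = κ₁ then expUnit (((y κ₀ : ℤ) : ℂ) • B) else 1)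
    {a : ℝ} (ha : 2 * Real.pi / ((N * L ^ (j + 1) : ℕ) : ℝ) ≤ a) (hs : LevelSmall d L j a)
    (S : Set (Site d → Fin d → Matrix n n ℂ))
    (hS : ∀ X : Site d → Fin d → Matrix n n ℂ, IsSkewDir X → IsPeriodicDir X ((N * L ^ (j + 1) : ℕ) : ℤ) → dirIter L (j + 1) W X = 0 → X ∈ S)
    {KG : ℝ}
    (hG : ∀ X ∈ S, IsPeriodicDir X ((N * L ^ (j + 1) : ℕ) : ℤ) → dirIter L (j + 1) W X = 0 → ∀ g : ℝ, 0 ≤ g →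
      (∀ Y : Site d → Fin d → Matrix n n ℂ, IsSkewDir Y → IsPeriodicDir Y ((N * L ^ (j + 1) : ℕ) : ℤ) → dirIter L (j + 1) W Y = 0 →
        |hess W X Y (perWin d (N * L ^ (j + 1)))| ≤ g * dirL1 Y (periodBox (d := d) (N * L ^ (j + 1)))) →
      ∀ z μ' ν', μ' ≠ ν' → ‖curlAt W X z μ' ν'‖ ≤ KG * g) : False := by
  classical
  have hN : 1 ≤ N := Nat.pos_of_ne_zero (NeZero.ne N)
  have hM2 : 2 ≤ L ^ (j + 1) := le_trans hL (Nat.le_self_pow (Nat.succ_ne_zero j) L)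
  have hP2 : 2 ≤ N * L ^ (j + 1) := le_trans hM2 (Nat.le_mul_of_pos_left _ hN)
  have hP0 : 0 < N * L ^ (j + 1) := by omega
  -- the norms of `e^{±B} − 1`
  have hθabs : |θ| = 2 * Real.pi / ((N * L ^ (j + 1) : ℕ) : ℝ) := by
    rw [hθ, abs_of_nonneg (by positivity)]
  have hn1 : ‖exp B - 1‖ ≤ a := by
    have h := norm_exp_smul_phase_sub_one_le hB 1
    rw [Complex.ofReal_one, one_smul, one_mul, hθabs] at h
    exact h.trans ha
  have hn2 : ‖exp (-B) - 1‖ ≤ a := by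
    have h := norm_exp_smul_phase_sub_one_le hB (-1)
    rw [show (((-1 : ℝ)) : ℂ) • B = -B by simp, neg_one_mul, abs_neg, hθabs] at h
    exact h.trans ha
  refine sliceLetter_false_constFlux hL j hκ hW (skew_phase hB) (expUnit_period_phase hB hP0 (by rw [hθ])) hn1 hn2 hs
    (skew_zeta h01 rfl) (zeta_sub_Ad_ne_zero h01 hB rfl ?_) S hS hG
  rw [hθ]
  exact exp_ne_one_of_two_le hP2

/-! ## §4 Packaged: an admissible background of F123d refuting its slice-solver letter, for every `d ≥ 2`, `card n ≥ 2`, `L ≥ 2`, `j` -/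

/-- **FOR EVERY `d ≥ 2`, `card n ≥ 2`, `L ≥ 2` AND EVERY LEVEL `j` THERE IS AN ADMISSIBLE BACKGROUND OF F123d AT WHICH ITS LETTER (L2) IS UNSATISFIABLE**: some `N ≥ 1`, `x ≥ 0` and a
unitary `(N·L^{j+1})`-periodic `W` with `LevelSmall d L j x`, `LevelSmall d L (j+1) x`, `SmallField W x`, tangent-critical, covariant plaquette gradient `0`, flux gradient `0`, such
that for every `S ⊇ {W-tangent skew periodic fields}` and every `K_G` the hypothesis `hG` fails. [folklore] -/
theorem exists_admissible_background_not_sliceLetter [Nonempty n] {d : ℕ} (hd : 2 ≤ d) (hn : ∃ i₀ i₁ : n, i₀ ≠ i₁) {L : ℕ} (hL : 2 ≤ L) (j : ℕ) :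
    ∃ (N : ℕ) (_ : NeZero N) (x : ℝ) (W : Site d → Fin d → (Matrix n n ℂ)ˣ),
      IsUnitaryCfg W ∧ IsPeriodicCfg W ((N * L ^ (j + 1) : ℕ) : ℤ) ∧ 0 ≤ x ∧ LevelSmall d L j x ∧ LevelSmall d L (j + 1) x ∧ SmallField W x ∧
      (∀ Y : Site d → Fin d → Matrix n n ℂ, IsSkewDir Y → IsPeriodicDir Y ((N * L ^ (j + 1) : ℕ) : ℤ) → dirIter L (j + 1) W Y = 0 →
        dAction W Y (perWin d (N * L ^ (j + 1))) = 0) ∧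
      (∀ (p : Site d) (μ κ : Fin d), κ ≠ μ →
        ‖Ad (W p μ) ((hol W (p + e μ) (plaqWord κ μ) : (Matrix n n ℂ)ˣ) : Matrix n n ℂ) - ((hol W p (plaqWord κ μ) : (Matrix n n ℂ)ˣ) : Matrix n n ℂ)‖ ≤ 0) ∧
      (∀ (z : Site d) (μ : Fin d) (π : T4AveragingDeficitWall.Plane d), ‖covGrad W (flux W) z μ π‖ ≤ 0) ∧
      ∀ (S : Set (Site d → Fin d → Matrix n n ℂ)),
        (∀ X : Site d → Fin d → Matrix n n ℂ, IsSkewDir X → IsPeriodicDir X ((N * L ^ (j + 1) : ℕ) : ℤ) → dirIter L (j + 1) W X = 0 → X ∈ S) →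
        ∀ KG : ℝ,
          ¬ (∀ X ∈ S, IsPeriodicDir X ((N * L ^ (j + 1) : ℕ) : ℤ) → dirIter L (j + 1) W X = 0 → ∀ g : ℝ, 0 ≤ g →
            (∀ Y : Site d → Fin d → Matrix n n ℂ, IsSkewDir Y → IsPeriodicDir Y ((N * L ^ (j + 1) : ℕ) : ℤ) → dirIter L (j + 1) W Y = 0 →
              |hess W X Y (perWin d (N * L ^ (j + 1)))| ≤ g * dirL1 Y (periodBox (d := d) (N * L ^ (j + 1)))) →
            ∀ z μ' ν', μ' ≠ ν' → ‖curlAt W X z μ' ν'‖ ≤ KG * g) := by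
  classical
  obtain ⟨i₀, i₁, h01⟩ := hn
  set κ₀ : Fin d := ⟨0, by omega⟩ with hκ₀
  set κ₁ : Fin d := ⟨1, by omega⟩ with hκ₁
  have hκ : κ₀ ≠ κ₁ := by simp [hκ₀, hκ₁, Fin.ext_iff]
  -- the torus size: `N` so large that `2π∕(N·L^{j+1})` is a multi-level-small radius at levels `j` and `j+1`
  set T : ℝ := twoLevelSmall d L * (2 * (L : ℝ) ^ 2) ^ (j + 1) with hT
  have hT0 : 0 ≤ T := by rw [hT]; unfold AveragingDeficitTwoLevelPrep.twoLevelSmall; positivity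
  set N : ℕ := ⌈2 * Real.pi * T⌉₊ + 1 with hNdef
  haveI : NeZero N := ⟨by omega⟩
  have hN1 : (2 * Real.pi * T : ℝ) ≤ N := by
    rw [hNdef]; push_cast
    exact (Nat.le_ceil _).trans (by linarith)
  have hNpos : (0 : ℝ) < N := by rw [hNdef]; positivity
  have hL1 : (1 : ℝ) ≤ L := by exact_mod_cast (le_trans (by norm_num) hL)
  have hM1 : (1 : ℝ) ≤ (L : ℝ) ^ (j + 1) := one_le_pow₀ hL1
  have hPpos : (0 : ℝ) < ((N * L ^ (j + 1) : ℕ) : ℝ) := by push_cast; positivity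
  obtain ⟨x, hxdef⟩ : ∃ x : ℝ, x = 2 * Real.pi / ((N * L ^ (j + 1) : ℕ) : ℝ) := ⟨_, rfl⟩
  have hx0 : 0 ≤ x := by rw [hxdef]; positivity
  -- `T·x ≤ 1`, hence both `LevelSmall` lines
  have hTx : T * x ≤ 1 := by
    rw [hxdef]
    push_cast
    rw [mul_div_assoc', div_le_one (by positivity)]
    calc T * (2 * Real.pi) = 2 * Real.pi * T := by ring
      _ ≤ N := hN1
      _ = N * 1 := (mul_one _).symm
      _ ≤ N * (L : ℝ) ^ (j + 1) := mul_le_mul_of_nonneg_left hM1 hNpos.le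
  have h2L : (1 : ℝ) ≤ 2 * (L : ℝ) ^ 2 := by nlinarith [one_le_pow₀ (n := 2) hL1]
  have hs1 : LevelSmall d L (j + 1) x := by
    refine levelSmall_of_pow (by omega) (j + 1) hx0 ?_
    rw [← hT]; exact hTx
  have hs : LevelSmall d L j x := by
    refine levelSmall_of_pow (by omega) j hx0 (le_trans ?_ hTx)
    rw [hT, pow_succ]
    have h0 : 0 ≤ twoLevelSmall d L * (2 * (L : ℝ) ^ 2) ^ j * x := by
      unfold AveragingDeficitTwoLevelPrep.twoLevelSmall; positivity
    calc twoLevelSmall d L * (2 * (L : ℝ) ^ 2) ^ j * x = twoLevelSmall d L * (2 * (L : ℝ) ^ 2) ^ j * x * 1 := (mul_one _).symm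
      _ ≤ twoLevelSmall d L * (2 * (L : ℝ) ^ 2) ^ j * x * (2 * (L : ℝ) ^ 2) := mul_le_mul_of_nonneg_left h2L h0
      _ = twoLevelSmall d L * ((2 * (L : ℝ) ^ 2) ^ j * (2 * (L : ℝ) ^ 2)) * x := by ring
  -- the matrices and the background
  obtain ⟨B, hB⟩ : ∃ B : Matrix n n ℂ, B = Matrix.diagonal (fun i => if i = i₀ then ((x : ℂ) * Complex.I) else 0) := ⟨_, rfl⟩
  obtain ⟨W, hWdef⟩ : ∃ W : Site d → Fin d → (Matrix n n ℂ)ˣ, W = fun y κ => if κ = κ₁ then expUnit (((y κ₀ : ℤ) : ℂ) • B) else 1 := ⟨_, rfl⟩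
  have hW : ∀ (y : Site d) (κ : Fin d), W y κ = if κ = κ₁ then expUnit (((y κ₀ : ℤ) : ℂ) • B) else 1 := fun y κ => by rw [hWdef]
  have hBs := skew_phase hB
  have hP0 : 0 < N * L ^ (j + 1) := by exact_mod_cast hPpos
  have hP1 : 1 ≤ N * L ^ (j + 1) := hP0
  have hBP := expUnit_period_phase hB hP0 hxdef
  have hθabs : |x| = x := abs_of_nonneg hx0
  have hn1 : ‖exp B - 1‖ ≤ x := by
    have h := norm_exp_smul_phase_sub_one_le hB 1
    rw [Complex.ofReal_one, one_smul, one_mul, hθabs] at h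
    exact h
  have hn2 : ‖exp (-B) - 1‖ ≤ x := by
    have h := norm_exp_smul_phase_sub_one_le hB (-1)
    rw [show (((-1 : ℝ)) : ℂ) • B = -B by simp, neg_one_mul, abs_neg, hθabs] at h
    exact h
  have hx1 : x < 1 := by
    -- `x ≤ 1∕T`-type smallness is far below `1`: use `T ≥ twoLevelSmall ≥ 65536`
    have hTge : (2 : ℝ) ≤ T := by
      rw [hT]
      unfold AveragingDeficitTwoLevelPrep.twoLevelSmall
      have hd0 : (0 : ℝ) ≤ d := Nat.cast_nonneg d
      have h1 : (1 : ℝ) ≤ ((d : ℝ) + 1) ^ 2 := one_le_pow₀ (by linarith)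
      have h2 : (1 : ℝ) ≤ ((d : ℝ) + 4) ^ 2 := one_le_pow₀ (by linarith)
      have h3 : (1 : ℝ) ≤ (L : ℝ) ^ (d + 4) := one_le_pow₀ hL1
      have h4 : (1 : ℝ) ≤ (2 * (L : ℝ) ^ 2) ^ (j + 1) := one_le_pow₀ h2L
      have h12 := one_le_mul_of_one_le_of_one_le h1 h2
      have h123 := one_le_mul_of_one_le_of_one_le h12 h3
      have h1234 := one_le_mul_of_one_le_of_one_le h123 h4
      nlinarith [h1234]
    nlinarith [hTx, hx0]
  refine ⟨N, inferInstance, x, W, isUnitaryCfg_constFlux hW hBs, isPeriodicCfg_constFlux hW hBP, hx0, hs, hs1,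
    smallField_constFlux hκ hW hn1 hn2, tanCritical_constFlux hκ hW hP1 hBP, fun p μ κ _ => plaqGrad_constFlux hκ hW p μ κ,
    fun z μ π => fluxGrad_constFlux hκ hW hBs hn1 hn2 hx1 z μ π, fun S hS KG hG => ?_⟩
  exact sliceLetter_false_witness hκ h01 hL j hxdef hB hW (le_of_eq hxdef.symm) hs S hS hG

end

end Summit.QuantumFields.BalabanUV.T4Continuum.NE7SliceLetterConstantFluxWitness
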